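import Literature.NumberTheory.Automorphic.VarmaTheorem92TracesProofs
import Literature.NumberTheory.Automorphic.VarmaCorollary93BaseChangeProofs
import HarnessLib

/-!
# Varma 2024, Thm. 1 at the unramified places (trace form) from the `2n`-dimensional input
# (Thm. 5.1 + Prop. 7.1) by Prop. 9.1 and quadratic base change — the descent in trace form

Topic `Literature/NumberTheory/Automorphic`; a PROOFS file (theorems only: no definition, no named
fact — D-0014/D-0026), sibling of `VarmaCorollary93BaseChangeProofs` (the same printed argument —
Cor. 9.3 "from Theorem 9.2 in conjunction with Lemma 1 of [So] using the same argument as in Theorem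
VII.1.9 of [HT]" — run for `IsGaloisCompatibleAt` from the raw hypothesis "Thm. 9.2") and of
`VarmaTheorem92TracesProofs` (Varma's (9.1): Thm. 9.2 in TRACE form, PROVED from the
`2n`-dimensional input `h57` = Thm. 5.1 + Prop. 7.1 with HLTT Cor. 6.27, by Prop. 9.1 = HLTT
Prop. 7.12).  Here the base change / identification / descent is run in trace form, so that the
named fact `Varma2024.theorem1_unramified_traces` (`VarmaUnramifiedWeilTraces`: Varma's Thm. 1 at
the unramified places, on the elements of `Γ_{K_v}` of every Frobenius degree) follows from `h57`
and the two Arthur–Clozel leaves ALONE — one printed level below Thm. 9.2, and without the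
`≺`-half of Thm. 9.2 (Cor. 8.12, Schneider–Zink types), which concerns Thm. 2.

I. Varma, *Local–global compatibility for regular algebraic cuspidal automorphic representations
when `ℓ ≠ p`*, Forum Math. Sigma 12 (2024) e21, doi:10.1017/fms.2024.7: Thm. 1 (p. 2), Thm. 5.1,
Prop. 7.1 (p. 20), Prop. 9.1 and the proof of Thm. 9.2 with (9.1) (pp. 30–31), Cor. 9.3 (p. 32).
M. Harris, R. Taylor, Ann. of Math. Stud. 151 (2001), proof of Thm. VII.1.9 (pp. 229–232): "Given
any finite place `y` of `L` we can choose an imaginary quadratic extension `A/ℚ` such that … `y`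
splits as `y'y''` in `LA` … `[R_l(Π)|_{W_{F_y}}] = [R_l(Res^L_{F_A}(Π))|_{W_{F_{y'}}}] = [r_l(ı⁻¹Π_y)]`".

## What is proved

* `GaloisRepresentations.decompositionSubgroup_le_range_absGaloisRestrict` — **at a place `v`
  completely split in the finite Galois `M/F`, every decomposition group `D_𝔓 ≤ Γ_F`, `𝔓 ∣ v`,
  lies in `res(Γ_M)`** (the decomposition-group companion of `inertia_le_range_absGaloisRestrict`
  of `ReciprocityGLnDescentProofs`: the decomposition subgroup of `Gal(M/F)` at the prime below `𝔓`
  has order `e f = 1`, Mathlib `Ideal.card_stabilizer_eq_card_inertia_mul_finrank`).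
* `GaloisRepresentations.FramedRep.charpoly_eq_of_equiv` — equivalent framed representations have
  the same characteristic polynomials elementwise (conjugacy, `FramedRep.exists_eq_conj_of_equiv`).
* `Varma2024.weilTrace_of_isGaloisCompatibleAt` — unramified compatibility at `v` gives the Weil
  traces at `v` (the pointwise content of `theorem1_unramified_traces_of_corollary93_unramified`).
* `Varma2024.weilTrace_of_restrictField` — **descent of the trace identity at a completely split
  place**: if `r|_{Γ_L}` satisfies the global trace identity (all Frobenius degrees) at the primes
  over the places `w ∣ v` of `L`, `v` completely split in `L`, then `r` has the Weil traces at `v`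
  on `Γ_{K_v}` — the elements of `Γ_{K_v}` land in `D_{𝔓₀} ≤ res(Γ_L)`
  (`decompositionSubgroup_adicCompletionPrime_eq_range`, the first theorem), Frobenii and inertia
  correspond under `res` (`isArithFrobAt_of_absGaloisRestrict_eq_pow`,
  `comap_inertia_comap_absIntegersMap`), and `q_w = q_v`.
* `Varma2024.exists_rep_member_of_prop71` — the representation `ρ_D` of a member `K_D = K(√-D)`
  from `theorem92_traces_of_prop71` applied to the strong base change `π_D`: compatible almost
  everywhere with the Frobenius datum of `π`, and with the global trace identity at every place over
  a rational `q ≠ ℓ` with `8q ∣ D + 1` (`q` splits in `ℚ(√-D) ⊆ K_D`).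
* `Varma2024.theorem1_unramified_traces_of_prop71` — **`theorem1_unramified_traces` from `h57`,
  `ArthurClozel1989_strongLifting_archimedean` and `ArthurClozel1989_strongLifting_cuspidal`**:
  ranks `0`, `1` and the HLTT places by `weilTrace_of_isGaloisCompatibleAt`; otherwise
  `[K : ℚ] ≥ 2`, a member `K_D` with `v` completely split and `8q ∣ D + 1`
  (`GoodPrime.exists_dvd_split`), `r|_{Γ_{K_D}} ≅ ρ_D` (`CompatibleAE.nonempty_equiv`: Chebotarev
  + Brauer–Nesbitt), transfer of the trace identity along the isomorphism
  (`FramedRep.charpoly_eq_of_equiv`) and descent (`weilTrace_of_restrictField`).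

So the exact residue of a discharge `theorem1_unramified_traces_holds` is now: the `2n`-dimensional
Shimura-variety statement `h57` (Varma Thm. 5.1 + Prop. 7.1 — ordinary `p`-adic automorphic forms on
`U(n,n)`, the Bernstein centre acting through the Hecke algebras — with HLTT Cor. 6.27 for the same
family), and the two Arthur–Clozel named facts; everything from there up (Prop. 9.1, (9.1), the
patching/descent of Cor. 9.3, the passage to `Γ_{K_v}`) is proved in the tree.

## References

* I. Varma, Forum Math. Sigma 12 (2024) e21: Thm. 1 (p. 2), Thm. 5.1, Prop. 7.1 (p. 20), Prop. 9.1,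
  Thm. 9.2 and its proof with (9.1) (pp. 30–31), Cor. 9.3 (p. 32); = arXiv:1411.2520v1.
  [VarmaFMS2024]
* M. Harris, R. Taylor, Ann. of Math. Stud. 151 (2001), proof of Thm. VII.1.9 (pp. 229–232).
  [HarrisTaylorAMS2001]
* M. Harris, K.-W. Lan, R. Taylor, J. Thorne, Res. Math. Sci. 3:37 (2016): Thm. A (p. 3), Cor. 6.27
  (p. 225), Prop. 7.12 (p. 232). [HarrisLanTaylorThorneRMS2016]
* J. Arthur, L. Clozel, Ann. of Math. Stud. 120 (1989), Ch. 3, Thm. 4.2 (a), Thm. 5.1.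
  [ArthurClozelAMS120]
* J. Neukirch, *Algebraic Number Theory* (1999), Ch. I §9 (9.3)–(9.6), Ch. II §9 Prop. (9.6).
  [NeukirchANT1999]
-/

noncomputable section

open scoped MatrixGroups Matrix Classical Polynomial NumberField IntermediateField Pointwise
open NumberField IsDedekindDomain Field Polynomial Filter

/-! ### §1. Decomposition groups at a completely split place lie in `res(Γ_M)` -/

namespace Literature.NumberTheory.GaloisRepresentations

section DecompositionRange

variable (F M : Type*) [Field F] [NumberField F] [Field M] [NumberField M] [Algebra F M]

/-- **The decomposition group at a completely split place lies in the image of `Γ_M → Γ_F`.**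
Let `M/F` be a finite Galois extension of number fields and `v` a finite place of `F` which
splits completely in `M` (`e(v) = ramificationIdxIn = 1`, `f(v) = inertiaDegIn = 1`).  Then for
every prime `𝔓 ∣ v` of `\bar ℤ_F` the decomposition group `D_𝔓 ≤ Γ_F` is contained in `res(Γ_M)`:
`res(Γ_M) = Gal(F̄/e(M))` for an `F`-embedding `e : M → F̄`
(`exists_mem_range_absGaloisRestrict_iff`); `γ ∈ D_𝔓` restricts through `e` to `γ_M ∈ Gal(M/F)`
(Mathlib `AlgEquiv.restrictNormal`) lying in the decomposition subgroup of `Gal(M/F)` at the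
prime `P = e⁻¹(𝔓) ∩ 𝓞 M` above `v`, whose order is `e(v) f(v) = 1` (Mathlib
`Ideal.card_stabilizer_eq_card_inertia_mul_finrank`, `Ideal.card_inertia_eq_ramificationIdxIn`);
so `γ_M = 1`, i.e. `γ` fixes `e(M)` pointwise.  The inertia analogue (for `v` merely unramified)
is `inertia_le_range_absGaloisRestrict` (`ReciprocityGLnDescentProofs`), whose proof this one
follows line by line.  Neukirch, *Algebraic Number Theory*, Ch. I §9, (9.3)–(9.6); Marcus,
Ch. 4, Thm. 28–29. [cite: NeukirchANT1999, Ch. I §9 (9.3)–(9.6)] -/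
theorem decompositionSubgroup_le_range_absGaloisRestrict [IsGalois F M]
    {v : HeightOneSpectrum (𝓞 F)} (he : v.asIdeal.ramificationIdxIn (𝓞 M) = 1)
    (hf : v.asIdeal.inertiaDegIn (𝓞 M) = 1) {𝔓 : Ideal (absIntegers (𝓞 F) F)}
    (h𝔓 : 𝔓 ∈ v.primesAbove) :
    𝔓.decompositionSubgroup (absoluteGaloisGroup F) ≤ (absGaloisRestrict F M).range := by
  classical
  obtain ⟨e, hrange⟩ := exists_mem_range_absGaloisRestrict_iff F M
  intro γ hγ
  rw [Ideal.mem_decompositionSubgroup_iff] at hγ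
  rw [hrange]
  -- `M` as a subfield of `F̄` through `e`, and `γ` restricted to it
  letI : Algebra M (AlgebraicClosure F) := e.toRingHom.toAlgebra
  haveI : IsScalarTower F M (AlgebraicClosure F) :=
    IsScalarTower.of_algebraMap_eq fun x ↦ (e.commutes x).symm
  set γA : AlgebraicClosure F ≃ₐ[F] AlgebraicClosure F := absoluteGaloisGroup.toAlgEquiv F γ
    with hγA
  set γM : M ≃ₐ[F] M := γA.restrictNormal M with hγM
  have hγM_apply : ∀ x : M, e (γM x) = γ • e x := fun x ↦
    AlgEquiv.restrictNormal_commutes γA M x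
  have hγM_inv_apply : ∀ x : M, e (γM⁻¹ x) = γ⁻¹ • e x := by
    intro x
    rw [eq_inv_smul_iff, ← hγM_apply, ← AlgEquiv.mul_apply, mul_inv_cancel, AlgEquiv.one_apply]
  -- the Galois group `Gal(M/F)` acting on `𝓞 M`
  haveI : Module.Finite (𝓞 F) (𝓞 M) := IsIntegralClosure.finite (𝓞 F) F M (𝓞 M)
  haveI : IsGaloisGroup (M ≃ₐ[F] M) (𝓞 F) (𝓞 M) :=
    IsGaloisGroup.of_isFractionRing (M ≃ₐ[F] M) (𝓞 F) (𝓞 M) F M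
  -- the ring homomorphism `𝓞 M → \bar ℤ_F`, `y ↦ e y`
  have hint : ∀ y : 𝓞 M, (e.toRingHom.comp (algebraMap (𝓞 M) M)) y ∈ absIntegers (𝓞 F) F := by
    intro y
    rw [mem_integralClosure_iff]
    have h1 : IsIntegral ℤ (e (y : M)) :=
      (RingOfIntegers.isIntegral_coe y).map e.toRingHom.toIntAlgHom
    exact h1.tower_top
  let ψ : 𝓞 M →+* absIntegers (𝓞 F) F :=
    (e.toRingHom.comp (algebraMap (𝓞 M) M)).codRestrict (absIntegers (𝓞 F) F) hint
  have hψ : ∀ y : 𝓞 M, ((ψ y : absIntegers (𝓞 F) F) : AlgebraicClosure F) = e (y : M) :=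
    fun _ ↦ rfl
  -- the prime `P = e⁻¹(𝔓) ∩ 𝓞 M` above `v`
  haveI : 𝔓.IsPrime := h𝔓.1
  haveI : v.asIdeal.IsPrime := v.isPrime
  set P : Ideal (𝓞 M) := 𝔓.comap ψ with hPdef
  haveI hPprime : P.IsPrime := Ideal.comap_isPrime ψ 𝔓
  have hψalg : ∀ r : 𝓞 F, ψ (algebraMap (𝓞 F) (𝓞 M) r) =
      algebraMap (𝓞 F) (absIntegers (𝓞 F) F) r := by
    intro r
    apply Subtype.ext
    rw [hψ]
    have h1 : ((algebraMap (𝓞 F) (𝓞 M) r : 𝓞 M) : M) = algebraMap F M (r : F) := by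
      rw [RingOfIntegers.coe_eq_algebraMap, RingOfIntegers.coe_eq_algebraMap,
        ← IsScalarTower.algebraMap_apply, ← IsScalarTower.algebraMap_apply]
    rw [h1, AlgHom.commutes]
    rfl
  haveI hPover : P.LiesOver v.asIdeal := by
    constructor
    ext r
    rw [h𝔓.2.over, Ideal.under, Ideal.under, Ideal.mem_comap, Ideal.mem_comap, hPdef,
      Ideal.mem_comap, hψalg]
  -- `ψ` intertwines `γ_M` on `𝓞 M` and `γ` on `\bar ℤ_F`
  have hψγ : ∀ y : 𝓞 M, ψ (γM • y) = γ • ψ y := by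
    intro y
    apply Subtype.ext
    rw [integralClosure.coe_smul, hψ, hψ, ← hγM_apply]
    congr 1
  have hψγinv : ∀ y : 𝓞 M, ψ (γM⁻¹ • y) = γ⁻¹ • ψ y := by
    intro y
    apply Subtype.ext
    rw [integralClosure.coe_smul, hψ, hψ, ← hγM_inv_apply]
    congr 1
  -- `γ_M` lies in the decomposition subgroup of `Gal(M/F)` at `P` …
  have hmem : γM ∈ MulAction.stabilizer (M ≃ₐ[F] M) P := by
    rw [MulAction.mem_stabilizer_iff]
    ext y
    rw [Ideal.mem_pointwise_smul_iff_inv_smul_mem, hPdef, Ideal.mem_comap, Ideal.mem_comap, hψγinv,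
      ← Ideal.mem_pointwise_smul_iff_inv_smul_mem, hγ]
  -- … which is trivial, `v` being completely split in `M`
  have hstab : MulAction.stabilizer (M ≃ₐ[F] M) P = ⊥ := by
    apply Subgroup.eq_bot_of_card_eq
    rw [Ideal.card_stabilizer_eq_card_inertia_mul_finrank (G := M ≃ₐ[F] M) v.asIdeal P,
      Ideal.card_inertia_eq_ramificationIdxIn (G := M ≃ₐ[F] M) v.asIdeal P, he,
      ← Ideal.inertiaDegIn_eq_inertiaDeg v.asIdeal P (M ≃ₐ[F] M), hf]
  rw [hstab, Subgroup.mem_bot] at hmem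
  -- so `γ` fixes `e(M)` pointwise
  intro x
  rw [← hγM_apply x, hmem, AlgEquiv.one_apply]

end DecompositionRange

/-! ### §2. Characteristic polynomials along an isomorphism -/

section Equiv

variable {G : Type*} [Group G] [TopologicalSpace G] {A : Type*} [CommRing A] [TopologicalSpace A]
  [IsTopologicalRing A] {n : ℕ}

/-- **Characteristic polynomials are invariants of the isomorphism class**, elementwise: if the
continuous representations underlying the framed `ρ, ρ'` are equivalent then
`charpoly ρ'(g) = charpoly ρ(g)` for every `g` (`ρ' = P ρ P⁻¹`, `FramedRep.exists_eq_conj_of_equiv`;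
Mathlib `Matrix.charpoly_units_conj`).  Serre 1968, Ch. I §1.1. [folklore] -/
theorem FramedRep.charpoly_eq_of_equiv {ρ ρ' : FramedRep G A n}
    (e : ContinuousRep.Equiv ρ.toContinuousRep ρ'.toContinuousRep) (g : G) :
    FramedRep.charpoly ρ' g = FramedRep.charpoly ρ g := by
  obtain ⟨P, rfl⟩ := FramedRep.exists_eq_conj_of_equiv ρ ρ' e
  simp only [FramedRep.charpoly, FramedRep.conj_apply, Units.val_mul, Matrix.coe_units_inv]
  exact Matrix.charpoly_units_conj P _

end Equiv

end Literature.NumberTheory.GaloisRepresentations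

namespace Literature.NumberTheory.Automorphic

namespace Varma2024

open Literature.NumberTheory.GaloisRepresentations
open Literature.NumberTheory.GaloisRepresentations.QuadraticFamily
open Literature.NumberTheory.Automorphic.PatchingFamily
open Literature.NumberTheory.Automorphic.HarrisLanTaylorThorne2016
open Literature.NumberTheory.GaloisRepresentations.IsNonarchimedeanLocalField (residueFieldCard)

variable {n : ℕ} {K : Type} [Field K] [NumberField K] {hcpt : isCompact_glFiniteIntegralLevel n K}
  {ℓ : ℕ} [Fact ℓ.Prime]

/-! ### §3. From compatibility at `v` to the Weil traces at `v` (pointwise) -/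

/-- **Unramified compatibility at `v` gives the Weil traces at `v`** (the pointwise content of
`theorem1_unramified_traces_of_corollary93_unramified`): if `r` is unramified at `v` with
arithmetic-Frobenius characteristic polynomial `P = arithFrobPolyOfSatake ı q_v n α` for the Satake
parameter `α` of `π` at `v` (`IsGaloisCompatibleAt`), then every `σ ∈ Γ_{K_v}` of Frobenius degree
`d` has `tr r(σ) = ∑_{b root of P} b^d`.  [cite: VarmaFMS2024, Thm. 1 (p. 2) and Cor. 9.3 (p. 32)]
[cite: NeukirchANT1999, Ch. II §9 Prop. (9.6)] -/
theorem weilTrace_of_isGaloisCompatibleAt {π : AutomorphicRepData (AutomorphyDatum.gl n K hcpt)}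
    {ι : PadicAlgCl ℓ ≃+* ℂ} {r : FramedGaloisRep K (PadicAlgCl ℓ) n} {v : HeightOneSpectrum (𝓞 K)}
    (h : IsGaloisCompatibleAt π ι r v) {α : Multiset ℂ} (hα : π.HasSatakeParamAt v α)
    (σ : absoluteGaloisGroup (v.adicCompletion K)) (d : ℤ) (hσ : IsFrobPow σ d) :
    (((r.toLocal v) σ : GL (Fin n) (PadicAlgCl ℓ)) : Matrix (Fin n) (Fin n) (PadicAlgCl ℓ)).trace
      = ((arithFrobPolyOfSatake ι v.residueCard n α).roots.map fun b => b ^ d).sum := by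
  obtain ⟨hunr, hfrob⟩ := h α hα
  have h𝔓 := adicCompletionPrime_mem_primesAbove K v
  obtain ⟨φ, hφ⟩ := exists_isFrobPow_one K v
  have hq : residueFieldCard (v.adicCompletion K) = Nat.card (𝓞 K ⧸ v.asIdeal) :=
    (residueFieldCard_adicCompletion_eq K v).trans v.residueCard_eq_card_quotient
  have hφg : IsArithFrobAt (𝓞 K) (absGaloisRestrict K (v.adicCompletion K) φ)
      (adicCompletionPrime K v) :=
    (isArithFrobAt_absGaloisRestrict_adicCompletionPrime_iff K v hq φ).mpr
      (isFrobPow_one_iff_isAbsArithFrob_holds.mp hφ)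
  have hP : ((r (absGaloisRestrict K (v.adicCompletion K) φ) : GL (Fin n) (PadicAlgCl ℓ)) :
      Matrix (Fin n) (Fin n) (PadicAlgCl ℓ)).charpoly = arithFrobPolyOfSatake ι v.residueCard n α :=
    hfrob _ h𝔓 _ hφg
  have hone : r (absGaloisRestrict K (v.adicCompletion K) (σ * (φ ^ d)⁻¹)) = 1 :=
    hunr _ h𝔓 _ (absGaloisRestrict_mul_zpow_inv_mem_inertia hσ hφ)
  have hστ : (r.toLocal v) σ = r (absGaloisRestrict K (v.adicCompletion K) φ) ^ d := by
    rw [FramedGaloisRep.toLocal_apply]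
    calc r (absGaloisRestrict K (v.adicCompletion K) σ)
        = r (absGaloisRestrict K (v.adicCompletion K) (σ * (φ ^ d)⁻¹ * φ ^ d)) := by
          rw [inv_mul_cancel_right]
      _ = r (absGaloisRestrict K (v.adicCompletion K) (σ * (φ ^ d)⁻¹)) *
            r (absGaloisRestrict K (v.adicCompletion K) φ) ^ d := by
          rw [map_mul (absGaloisRestrict K (v.adicCompletion K)) _ (φ ^ d), map_mul r, map_zpow,
            map_zpow]
      _ = r (absGaloisRestrict K (v.adicCompletion K) φ) ^ d := by rw [hone, one_mul]
  rw [hστ, gl_trace_zpow_eq_sum_roots_zpow, hP]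

/-! ### §4. The Weil traces at `v` from the global trace identity at the prime `𝔓₀ ∣ v`, descended
from a completely split quadratic extension -/

/-- **Descent of the trace identity at a completely split place, and passage to `Γ_{K_v}`.**  Let
`L/K` be finite Galois, `v ∤ ℓ` a place of `K` completely split in `L` (`e = f = 1`), `r : Γ_K →
GL_n(ℚ̄_ℓ)`, and suppose that the restriction `r|_{Γ_L}` satisfies, at every place `w ∣ v` of `L`,
the global trace identity with the polynomial `P_w = arithFrobPolyOfSatake ı q_w n α`: for every
prime `𝔔 ∣ w` of `\bar ℤ_L`, every arithmetic Frobenius `φ'` at `𝔔`, every `d ∈ ℤ` and every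
`σ' ∈ Γ_L` with `σ' (φ'^d)⁻¹ ∈ I_𝔔`, `tr r(res σ') = ∑_{b root of P_w} b^d`.  Then every
`σ ∈ Γ_{K_v}` of Frobenius degree `d` has `tr r(σ) = ∑_{b root of P_v} b^d`
(`P_v = arithFrobPolyOfSatake ı q_v n α`).  Proof: `σ` and a local arithmetic Frobenius `φ_v` map
into the decomposition group of the prime `𝔓₀ ∣ v` cut out by `K̄ → \bar K_v`
(`decompositionSubgroup_adicCompletionPrime_eq_range`), with `res σ · (res φ_v)^{-d} ∈ I_{𝔓₀}`;
the decomposition group lies in `res(Γ_L)` (`decompositionSubgroup_le_range_absGaloisRestrict`), so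
`res σ = res σ'`, `res φ_v = res φ'`; for the prime `𝔔` of `\bar ℤ_L` corresponding to `𝔓₀`,
above a place `w ∣ v` with `f(w|v) = 1`, `φ'` is an arithmetic Frobenius at `𝔔`
(`isArithFrobAt_of_absGaloisRestrict_eq_pow`) and `σ' (φ'^d)⁻¹ ∈ I_𝔔`
(`comap_inertia_comap_absIntegersMap`); finally `q_w = q_v`.
[cite: HarrisTaylorAMS2001, proof of Thm. VII.1.9 (p. 231)] [cite: NeukirchANT1999, Ch. I §9 (9.3)–(9.6), Ch. II §9 Prop. (9.6)] -/
theorem weilTrace_of_restrictField {L : Type} [Field L] [NumberField L] [Algebra K L]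
    [IsGalois K L] (ι : PadicAlgCl ℓ ≃+* ℂ) (r : FramedGaloisRep K (PadicAlgCl ℓ) n)
    {v : HeightOneSpectrum (𝓞 K)} (he : v.asIdeal.ramificationIdxIn (𝓞 L) = 1)
    (hf : v.asIdeal.inertiaDegIn (𝓞 L) = 1) (α : Multiset ℂ)
    (h : ∀ w : HeightOneSpectrum (𝓞 L), w.asIdeal.under (𝓞 K) = v.asIdeal →
      ∀ 𝔔 ∈ w.primesAbove, ∀ φ' : absoluteGaloisGroup L, IsArithFrobAt (𝓞 L) φ' 𝔔 →
      ∀ (d : ℤ) (σ' : absoluteGaloisGroup L),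
        σ' * (φ' ^ d)⁻¹ ∈ 𝔔.inertia (absoluteGaloisGroup L) →
        ((r (absGaloisRestrict K L σ') : GL (Fin n) (PadicAlgCl ℓ)) :
            Matrix (Fin n) (Fin n) (PadicAlgCl ℓ)).trace =
          ((arithFrobPolyOfSatake ι w.residueCard n α).roots.map fun b => b ^ d).sum)
    (σ : absoluteGaloisGroup (v.adicCompletion K)) (d : ℤ) (hσ : IsFrobPow σ d) :
    (((r.toLocal v) σ : GL (Fin n) (PadicAlgCl ℓ)) : Matrix (Fin n) (Fin n) (PadicAlgCl ℓ)).trace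
      = ((arithFrobPolyOfSatake ι v.residueCard n α).roots.map fun b => b ^ d).sum := by
  -- local → global at `𝔓₀`
  have h𝔓₀ := adicCompletionPrime_mem_primesAbove K v
  haveI : (adicCompletionPrime K v).IsPrime := h𝔓₀.1
  obtain ⟨φl, hφl⟩ := exists_isFrobPow_one K v
  have hq : residueFieldCard (v.adicCompletion K) = Nat.card (𝓞 K ⧸ v.asIdeal) :=
    (residueFieldCard_adicCompletion_eq K v).trans v.residueCard_eq_card_quotient
  set φ : absoluteGaloisGroup K := absGaloisRestrict K (v.adicCompletion K) φl with hφdef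
  have hφ : IsArithFrobAt (𝓞 K) φ (adicCompletionPrime K v) :=
    (isArithFrobAt_absGaloisRestrict_adicCompletionPrime_iff K v hq φl).mpr
      (isFrobPow_one_iff_isAbsArithFrob_holds.mp hφl)
  set σg : absoluteGaloisGroup K := absGaloisRestrict K (v.adicCompletion K) σ with hσgdef
  have hσg : σg * (φ ^ d)⁻¹ ∈ (adicCompletionPrime K v).inertia (absoluteGaloisGroup K) := by
    rw [hσgdef, hφdef, ← map_zpow, ← map_inv, ← map_mul]
    exact absGaloisRestrict_mul_zpow_inv_mem_inertia hσ hφl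
  have hσD : σg ∈ (adicCompletionPrime K v).decompositionSubgroup (absoluteGaloisGroup K) := by
    rw [decompositionSubgroup_adicCompletionPrime_eq_range]; exact ⟨σ, rfl⟩
  have hφD : φ ∈ (adicCompletionPrime K v).decompositionSubgroup (absoluteGaloisGroup K) := by
    rw [decompositionSubgroup_adicCompletionPrime_eq_range]; exact ⟨φl, rfl⟩
  rw [FramedGaloisRep.toLocal_apply]
  change ((r σg : GL (Fin n) (PadicAlgCl ℓ)) : Matrix (Fin n) (Fin n) (PadicAlgCl ℓ)).trace = _
  -- `σg = res σ'`, `φ = res φ'` with `σ', φ' ∈ Γ_L`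
  obtain ⟨σ', hσ'⟩ := decompositionSubgroup_le_range_absGaloisRestrict K L he hf h𝔓₀ hσD
  obtain ⟨φ', hφ'⟩ := decompositionSubgroup_le_range_absGaloisRestrict K L he hf h𝔓₀ hφD
  change absGaloisRestrict K L σ' = σg at hσ'
  change absGaloisRestrict K L φ' = φ at hφ'
  -- the prime `𝔔` of `\bar ℤ_L` corresponding to `𝔓₀`, above a place `w ∣ v` with `f(w|v) = 1`
  obtain ⟨𝔔, h𝔔prime, h𝔔⟩ := exists_isPrime_comap_absIntegersMap_eq K L (adicCompletionPrime K v)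
  haveI := h𝔔prime
  obtain ⟨w, hw, h𝔔w, -⟩ :=
    exists_heightOneSpectrum_of_comap_absIntegersMap_mem_primesAbove (K := K) (M := L)
      (𝔔 := 𝔔) (h𝔔.symm ▸ h𝔓₀)
  have hfw : w.asIdeal.inertiaDeg (𝓞 K) = 1 := by rw [inertiaDeg_eq_inertiaDegIn hw, hf]
  -- `φ'` is an arithmetic Frobenius at `𝔔`, and `σ' (φ'^d)⁻¹ ∈ I_𝔔`
  have hφ'F : IsArithFrobAt (𝓞 L) φ' 𝔔 := by
    refine isArithFrobAt_of_absGaloisRestrict_eq_pow hw h𝔔w (Φ := φ) ?_ ?_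
    · rw [h𝔔]; exact hφ
    · rw [hfw, pow_one]; exact hφ'
  have hσ'I : σ' * (φ' ^ d)⁻¹ ∈ 𝔔.inertia (absoluteGaloisGroup L) := by
    rw [← comap_inertia_comap_absIntegersMap K L 𝔔, Subgroup.mem_comap, h𝔔]
    change absGaloisRestrict K L (σ' * (φ' ^ d)⁻¹) ∈ _
    rwa [map_mul, map_inv, map_zpow, hσ', hφ']
  have key := h w hw 𝔔 h𝔔w φ' hφ'F d σ' hσ'I
  rw [hσ'] at key
  rwa [residueCard_eq_residueCard_pow_inertiaDeg hw, hfw, pow_one] at key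

/-! ### §5. The representation of a member `K(√-D)`, from Thm. 5.1 + Prop. 7.1 -/

/-- **The representation of a member of the family `K(√-D)`, from the `2n`-dimensional input**
(the analogue of `exists_rep_member_of_theorem92`, with (9.1) in trace form —
`theorem92_traces_of_prop71` — in place of Thm. 9.2).  Let `K` be totally real or CM, `π` cuspidal
regular algebraic on `GL_n(𝔸_K)`, `n ≥ 2`, `[K : ℚ] ≥ 2` unless `n > 2`, `E` a Frobenius datum of
`π`, and `B` a set of rational primes containing every prime below a place of `K` ramified over `ℤ`
or a ramified place of `π`.  For `D ∈ GoodPrime K (8ℓ) B`: the strong base change `π_D` of `π` to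
`K_D = K(√-D)` (`hBC`, at the ramified place above `D` where `π` is unramified) is cuspidal and
regular algebraic (`harch`); `K_D` is CM and contains `F₀ = ℚ(√-D)`, imaginary quadratic, in which
`ℓ` and every `q` with `8q ∣ D + 1` split; `theorem92_traces_of_prop71` gives `ρ`, semisimple, with
**(i)** `ρ` compatible almost everywhere with `E` (HLTT alternative at the cofinitely many good
places, `t_{π_D,w} = t_{π,v}^{f}`); **(ii)** for every rational `q ≠ ℓ` with `8q ∣ D + 1` and every
place `w ∣ q` of `K_D` at which `π_D` has a Satake parameter `α`, the global trace identity
`tr ρ(σ) = ∑_j b_j^d` at every `σ ∈ Γ_{K_D}` of Frobenius degree `d` at a prime over `w`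
(`b_j` the roots of `arithFrobPolyOfSatake ı q_w n α`), together with the transfer of Satake
parameters from `v ∣ q` to the `w ∣ v` (`f(w|v) = 1`).
[cite: VarmaFMS2024, proof of Thm. 9.2 with (9.1) (p. 31) and proof of Cor. 9.3 (p. 32)]
[cite: HarrisTaylorAMS2001, proof of Thm. VII.1.9 (pp. 229–231)] -/
theorem exists_rep_member_of_prop71
    (h57 : ∀ {n : ℕ} {K : Type} [Field K] [NumberField K]
      (hcpt : isCompact_glFiniteIntegralLevel n K) (p : ℕ) [Fact p.Prime], 1 < n → IsCMField K →
      ∀ (F₀ : IntermediateField ℚ K), Module.finrank ℚ F₀ = 2 ∧ IsTotallyComplex F₀ →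
      HasTwoPrimesOver F₀ p → (Module.finrank ℚ K = 2 → 2 < n) →
      ∀ (π : CuspidalAutomorphicRepData n K hcpt), π.1.IsRegularAlgebraic →
      ∀ (ι : PadicAlgCl p ≃+* ℂ),
      ∃ (N₀ : ℕ) (R : ℕ → FramedGaloisRep K (PadicAlgCl p) (2 * n))
        (B : HeightOneSpectrum (𝓞 K) → Multiset (PadicAlgCl p))
        (E₂ : HeightOneSpectrum (𝓞 K) → Ideal (absIntegers (𝓞 K) K) → absoluteGaloisGroup K →
          ℤ → absoluteGaloisGroup K → Multiset (PadicAlgCl p)),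
        (∀ N, N₀ ≤ N → (R N).toGaloisRep.IsSemisimple) ∧
        (∀ v, Multiset.card (B v) = n ∧ (0 : PadicAlgCl p) ∉ B v) ∧
        (∀ v 𝔓 φ d σ, Multiset.card (E₂ v 𝔓 φ d σ) = n ∧ (0 : PadicAlgCl p) ∉ E₂ v 𝔓 φ d σ) ∧
        (∀ q : ℕ, q.Prime → q ≠ p →
          (HasTwoPrimesOver F₀ q ∨ Algebra.IsUnramifiedIn (𝓞 K) (Ideal.span {(q : ℤ)})) →
          π.1.IsUnramifiedAbove q →
          ∀ v : HeightOneSpectrum (𝓞 K), ((q : ℕ) : 𝓞 K) ∈ v.asIdeal →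
          ∀ α : Multiset ℂ, π.1.HasSatakeParamAt v α → ∀ N, N₀ ≤ N →
            (R N).IsUnramifiedAt v ∧
            (R N).HasFrobCharpolyAt v (arithFrobPolyOfSatake ι v.residueCard n α *
              ((B v).map fun b ↦ X - C (b * ((v.residueCard : PadicAlgCl p)⁻¹) ^ (2 * N))).prod)) ∧
        (∀ q : ℕ, q.Prime → q ≠ p → HasTwoPrimesOver F₀ q →
          ∀ v : HeightOneSpectrum (𝓞 K), ((q : ℕ) : 𝓞 K) ∈ v.asIdeal →
          ∀ α : Multiset ℂ, π.1.HasSatakeParamAt v α →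
          ∀ 𝔓 ∈ v.primesAbove, ∀ φ : absoluteGaloisGroup K, IsArithFrobAt (𝓞 K) φ 𝔓 →
          ∀ d : ℤ, d ≠ 0 → ∀ σ : absoluteGaloisGroup K,
            σ * (φ ^ d)⁻¹ ∈ 𝔓.inertia (absoluteGaloisGroup K) → ∀ N, N₀ ≤ N →
            (FramedRep.charpoly (R N) σ).roots =
              (arithFrobPolyOfSatake ι v.residueCard n α).roots.map (· ^ d) +
                (E₂ v 𝔓 φ d σ).map
                  (· * (v.residueCard : PadicAlgCl p) ^ (-(2 * d * (N : ℤ))))))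
    (harch : ArthurClozel1989_strongLifting_archimedean)
    (hBC : ArthurClozel1989_strongLifting_cuspidal)
    (hn : 1 < n) (hKn : Module.finrank ℚ K = 1 → 2 < n) (hK : IsTotallyReal K ∨ IsCMField K)
    (π : CuspidalAutomorphicRepData n K hcpt) (hπ : π.1.IsRegularAlgebraic) (ι : PadicAlgCl ℓ ≃+* ℂ)
    (E : HeightOneSpectrum (𝓞 K) → Multiset (PadicAlgCl ℓ))
    (hE : ∀ (v : HeightOneSpectrum (𝓞 K)) (α : Multiset ℂ), π.1.HasSatakeParamAt v α →
      ((E v).map fun a ↦ X - C a).prod = arithFrobPolyOfSatake ι v.residueCard n α)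
    {B : Set ℕ}
    (hB : ∀ D : ℕ, D.Prime → D ∉ B → ∀ v : HeightOneSpectrum (𝓞 K), ((D : ℕ) : 𝓞 K) ∈ v.asIdeal →
      Algebra.IsUnramifiedAt ℤ v.asIdeal ∧ π.1.IsUnramifiedAt v)
    (i : GoodPrime K (8 * ℓ) B) :
    ∃ (P : CuspidalAutomorphicRepData n (sqrtNegField K i.1)
        (isCompact_glFiniteIntegralLevel_holds n (sqrtNegField K i.1)))
      (ρ : FramedGaloisRep (sqrtNegField K i.1) (PadicAlgCl ℓ) n),
      IsUnramifiedBaseChangeLift π.1 P.1 ∧ ρ.toGaloisRep.IsSemisimple ∧ CompatibleAE E ρ ∧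
      ∀ q : ℕ, q.Prime → q ≠ ℓ → 8 * q ∣ i.1 + 1 →
        (∀ w : HeightOneSpectrum (𝓞 (sqrtNegField K i.1)),
            ((q : ℕ) : 𝓞 (sqrtNegField K i.1)) ∈ w.asIdeal →
          ∀ α : Multiset ℂ, P.1.HasSatakeParamAt w α →
          ∀ 𝔔 ∈ w.primesAbove, ∀ φ : absoluteGaloisGroup (sqrtNegField K i.1),
            IsArithFrobAt (𝓞 (sqrtNegField K i.1)) φ 𝔔 →
          ∀ (d : ℤ) (σ : absoluteGaloisGroup (sqrtNegField K i.1)),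
            σ * (φ ^ d)⁻¹ ∈ 𝔔.inertia (absoluteGaloisGroup (sqrtNegField K i.1)) →
            ((ρ σ : GL (Fin n) (PadicAlgCl ℓ)) : Matrix (Fin n) (Fin n) (PadicAlgCl ℓ)).trace =
              (((arithFrobPolyOfSatake ι w.residueCard n α).roots.map fun b ↦ b ^ d).sum)) ∧
        ∀ v : HeightOneSpectrum (𝓞 K), ((q : ℕ) : 𝓞 K) ∈ v.asIdeal →
          ∀ w : HeightOneSpectrum (𝓞 (sqrtNegField K i.1)), w.asIdeal.under (𝓞 K) = v.asIdeal →
            ∀ α : Multiset ℂ, π.1.HasSatakeParamAt v α → P.1.HasSatakeParamAt w α := by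
  classical
  have hℓ : ℓ.Prime := Fact.out
  have hD : i.1.Prime := i.2.1
  have hD0 : i.1 ≠ 0 := i.ne_zero
  have hDℓ : 8 * ℓ ∣ i.1 + 1 := i.2.2.1
  -- the member field `L = K(√-D)` and its level structure
  set hL : isCompact_glFiniteIntegralLevel n (sqrtNegField K i.1) :=
    isCompact_glFiniteIntegralLevel_holds n (sqrtNegField K i.1)
  have hl2 : (Module.finrank K (sqrtNegField K i.1)).Prime := by
    rw [finrank_sqrtNegField]; exact Nat.prime_two
  -- a ramified place above `D` at which `π` is unramified
  obtain ⟨v₀, hv₀⟩ := exists_heightOneSpectrum_natCast_mem K hD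
  obtain ⟨hunrZ, hπv₀⟩ := hB i.1 hD i.2.2.2.1 v₀ hv₀
  have hram : ¬ Algebra.IsUnramifiedIn (𝓞 (sqrtNegField K i.1)) v₀.asIdeal :=
    not_isUnramifiedIn_sqrtNegField v₀ (intValuation_natCast_eq_of_isUnramifiedAt hD v₀ hv₀ hunrZ)
  -- the strong base change `Π = π_D`, cuspidal and regular algebraic
  obtain ⟨P, hP⟩ := hBC n K (sqrtNegField K i.1) hl2 hcpt π ⟨v₀, hram, hπv₀⟩ hL
  have hPra : P.1.IsRegularAlgebraic := hP.isRegularAlgebraic harch hl2 hπ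
  -- `L` is CM and contains `ℚ(√-D)`, in which `ℓ` and every `q` with `8q ∣ D+1` split
  have hCM : IsCMField (sqrtNegField K i.1) := i.isCMField hK
  obtain ⟨F₀, hF₀, hF₀split⟩ :=
    exists_intermediateField_hasTwoPrimesOver (K := K) (D := i.1) hD0
  -- "if `F⁺ = ℚ`, assume `n > 2`": `[L : ℚ] = 2 [K : ℚ]` is `2` only for `K = ℚ`
  have hLn : Module.finrank ℚ (sqrtNegField K i.1) = 2 → 2 < n := by
    intro h2
    apply hKn
    have hmul := Module.finrank_mul_finrank ℚ K (sqrtNegField K i.1)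
    rw [finrank_sqrtNegField, h2] at hmul
    omega
  -- (9.1) in trace form, with HLTT's Thm. 7.13, for `Π`
  obtain ⟨ρ, hρss, h713ρ, hTrρ⟩ :=
    theorem92_traces_of_prop71 h57 hL ℓ hn hCM F₀ hF₀ (hF₀split ℓ hℓ hDℓ) hLn P hPra ι
  refine ⟨P, ρ, hP, hρss, ?_, ?_⟩
  · -- (i) compatibility almost everywhere with the datum of `π` (HLTT alternative)
    have hgood := (finite_setOf_not_exists_goodPrime P.1 P.1.hasSatakeParamAt_cofinite_holds ℓ
      hℓ).compl_mem_cofinite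
    have hunrK : ∀ᶠ v : HeightOneSpectrum (𝓞 K) in cofinite,
        Algebra.IsUnramifiedIn (𝓞 (sqrtNegField K i.1)) v.asIdeal := by
      filter_upwards [(GaloisRepresentations.finite_setOf_not_isUnramifiedIn K
        (sqrtNegField K i.1)).compl_mem_cofinite] with v hv
      simpa using hv
    have hπunr : ∀ᶠ v : HeightOneSpectrum (𝓞 K) in cofinite, π.1.IsUnramifiedAt v :=
      π.1.hasSatakeParamAt_cofinite_holds
    show ∀ᶠ w : HeightOneSpectrum (𝓞 (sqrtNegField K i.1)) in cofinite, _
    filter_upwards [hgood, eventually_under (E := sqrtNegField K i.1) hunrK,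
      eventually_under (E := sqrtNegField K i.1) hπunr] with w hw hwunr hwπ
    simp only [Set.mem_compl_iff, Set.mem_setOf_eq, not_not] at hw
    obtain ⟨q, hq, hqℓ, hqunr, hPq, hqw⟩ := hw
    obtain ⟨α, hα⟩ := hwπ (w.under (𝓞 K)) rfl
    have hβ := hP w (w.under (𝓞 K)) α rfl (hwunr _ rfl) hα
    obtain ⟨hunr_w, hch⟩ := h713ρ q hq hqℓ (Or.inr hqunr) hPq w hqw _ hβ
    refine ⟨hunr_w, ?_⟩
    rw [GaloisRepresentations.residueCard_eq_residueCard_pow_inertiaDeg (v := w.under (𝓞 K))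
      (w := w) rfl, arithFrobPolyOfSatake_pow] at hch
    have hroots : E (w.under (𝓞 K)) =
        (arithFrobPolyOfSatake ι (w.under (𝓞 K)).residueCard n α).roots := by
      rw [← hE _ α hα, Polynomial.roots_multiset_prod_X_sub_C]
    rw [frobPoly_eq_prod_map_pow, hroots]
    exact hch
  · -- (ii) the trace identity at the places over `q` with `8q ∣ D + 1` (first alternative),
    -- and the transfer of Satake parameters to the members
    intro q hq hqℓ hqD
    refine ⟨fun w hqw α hα 𝔔 h𝔔 φ hφ d σ hσ ↦
      hTrρ q hq hqℓ (hF₀split q hq hqD) w hqw α hα 𝔔 h𝔔 φ hφ d σ hσ, ?_⟩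
    intro v hqv w hwv α hα
    have hsplit : (v.asIdeal.primesOver (𝓞 (sqrtNegField K i.1))).ncard =
        Module.finrank K (sqrtNegField K i.1) := by
      rw [finrank_sqrtNegField]
      exact ncard_primesOver_sqrtNegField_eq_two v hq hqv hqD
    have hunr : Algebra.IsUnramifiedIn (𝓞 (sqrtNegField K i.1)) v.asIdeal :=
      isUnramifiedIn_of_ncard_eq_finrank v hsplit
    have hf : w.asIdeal.inertiaDeg (𝓞 K) = 1 := inertiaDeg_eq_one_of_ncard_eq_finrank v hsplit w hwv
    have h := hP w v α hwv hunr hα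
    rw [hf] at h
    simpa using h

/-! ### §6. Thm. 1 at the unramified places (trace form) from Thm. 5.1 + Prop. 7.1 and the
Arthur–Clozel leaves -/

/-- **Varma 2024, Thm. 1 at the unramified places in trace form
(`Varma2024.theorem1_unramified_traces`) from the `2n`-dimensional Shimura-variety input and
quadratic base change — the printed route Thm. 5.1 + Prop. 7.1 ⟹ (9.1) [Prop. 9.1] ⟹ Cor. 9.3 /
Thm. 1 [Lemma 1 of [So] as in HT Thm. VII.1.9], PROVED except for its three printed leaves.**
Granted (1) the raw hypothesis `h57` — Varma's Thm. 5.1 + Prop. 7.1 (with HLTT's Cor. 6.27 for the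
same family `R_{p,ı}(π, M)`), in the tree's unramified-place vocabulary, see
`theorem92_traces_of_prop71` —, (2) the archimedean clause and (3) the strong cuspidal base change in
prime degree of Arthur–Clozel (`ArthurClozel1989_strongLifting_archimedean`,
`ArthurClozel1989_strongLifting_cuspidal`), every continuous semisimple `r : Γ_K → GL_n(ℚ̄_ℓ)`
with Harris–Lan–Taylor–Thorne's property, `K` totally real or CM, has at every `v ∤ ℓ` with `π_v`
unramified of Satake parameter `α` the Weil traces `tr r(σ) = ∑_j b_j^d` (`σ ∈ Γ_{K_v}` of Frobenius
degree `d`, `b_j` the roots of `arithFrobPolyOfSatake ı q_v n α`).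
Proof.  Ranks `0`, `1`, and the places over a rational `q` above which `π` is unramified:
compatibility at `v` holds outright (`corollary93_unramified_rank_zero/one`, HLTT-compatibility) and
gives the traces (`weilTrace_of_isGaloisCompatibleAt`).  Otherwise `[K : ℚ] ≥ 2`; choose
`D ∈ GoodPrime K (8ℓ) B` with `8q ∣ D + 1` in which `v` splits completely
(`GoodPrime.exists_dvd_split`); let `π_D`, `ρ_D` be as in `exists_rep_member_of_prop71`;
`r|_{Γ_{K_D}} ≅ ρ_D` (both compatible almost everywhere with the datum of `π`: Chebotarev +
Brauer–Nesbitt, `CompatibleAE.nonempty_equiv`), so `charpoly r(res σ') = charpoly ρ_D(σ')` for all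
`σ' ∈ Γ_{K_D}` (`FramedRep.charpoly_eq_of_equiv`) and `r|_{Γ_{K_D}}` inherits the global trace
identity of `ρ_D` at the places `w ∣ v`; it descends to the Weil traces of `r` at the completely
split `v` (`weilTrace_of_restrictField`).
[cite: VarmaFMS2024, Thm. 1 (p. 2); Thm. 5.1; Prop. 7.1 (p. 20); proof of Thm. 9.2 with (9.1) (p. 31); Cor. 9.3 and its proof (p. 32)]
[cite: HarrisTaylorAMS2001, proof of Thm. VII.1.9 (pp. 229–232)]
[cite: HarrisLanTaylorThorneRMS2016, Cor. 6.27 (p. 225), Prop. 7.12 (p. 232)] -/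
theorem theorem1_unramified_traces_of_prop71
    (h57 : ∀ {n : ℕ} {K : Type} [Field K] [NumberField K]
      (hcpt : isCompact_glFiniteIntegralLevel n K) (p : ℕ) [Fact p.Prime], 1 < n → IsCMField K →
      ∀ (F₀ : IntermediateField ℚ K), Module.finrank ℚ F₀ = 2 ∧ IsTotallyComplex F₀ →
      HasTwoPrimesOver F₀ p → (Module.finrank ℚ K = 2 → 2 < n) →
      ∀ (π : CuspidalAutomorphicRepData n K hcpt), π.1.IsRegularAlgebraic →
      ∀ (ι : PadicAlgCl p ≃+* ℂ),
      ∃ (N₀ : ℕ) (R : ℕ → FramedGaloisRep K (PadicAlgCl p) (2 * n))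
        (B : HeightOneSpectrum (𝓞 K) → Multiset (PadicAlgCl p))
        (E₂ : HeightOneSpectrum (𝓞 K) → Ideal (absIntegers (𝓞 K) K) → absoluteGaloisGroup K →
          ℤ → absoluteGaloisGroup K → Multiset (PadicAlgCl p)),
        (∀ N, N₀ ≤ N → (R N).toGaloisRep.IsSemisimple) ∧
        (∀ v, Multiset.card (B v) = n ∧ (0 : PadicAlgCl p) ∉ B v) ∧
        (∀ v 𝔓 φ d σ, Multiset.card (E₂ v 𝔓 φ d σ) = n ∧ (0 : PadicAlgCl p) ∉ E₂ v 𝔓 φ d σ) ∧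
        (∀ q : ℕ, q.Prime → q ≠ p →
          (HasTwoPrimesOver F₀ q ∨ Algebra.IsUnramifiedIn (𝓞 K) (Ideal.span {(q : ℤ)})) →
          π.1.IsUnramifiedAbove q →
          ∀ v : HeightOneSpectrum (𝓞 K), ((q : ℕ) : 𝓞 K) ∈ v.asIdeal →
          ∀ α : Multiset ℂ, π.1.HasSatakeParamAt v α → ∀ N, N₀ ≤ N →
            (R N).IsUnramifiedAt v ∧
            (R N).HasFrobCharpolyAt v (arithFrobPolyOfSatake ι v.residueCard n α *
              ((B v).map fun b ↦ X - C (b * ((v.residueCard : PadicAlgCl p)⁻¹) ^ (2 * N))).prod)) ∧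
        (∀ q : ℕ, q.Prime → q ≠ p → HasTwoPrimesOver F₀ q →
          ∀ v : HeightOneSpectrum (𝓞 K), ((q : ℕ) : 𝓞 K) ∈ v.asIdeal →
          ∀ α : Multiset ℂ, π.1.HasSatakeParamAt v α →
          ∀ 𝔓 ∈ v.primesAbove, ∀ φ : absoluteGaloisGroup K, IsArithFrobAt (𝓞 K) φ 𝔓 →
          ∀ d : ℤ, d ≠ 0 → ∀ σ : absoluteGaloisGroup K,
            σ * (φ ^ d)⁻¹ ∈ 𝔓.inertia (absoluteGaloisGroup K) → ∀ N, N₀ ≤ N →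
            (FramedRep.charpoly (R N) σ).roots =
              (arithFrobPolyOfSatake ι v.residueCard n α).roots.map (· ^ d) +
                (E₂ v 𝔓 φ d σ).map
                  (· * (v.residueCard : PadicAlgCl p) ^ (-(2 * d * (N : ℤ))))))
    (harch : ArthurClozel1989_strongLifting_archimedean)
    (hBC : ArthurClozel1989_strongLifting_cuspidal) : theorem1_unramified_traces := by
  intro n K _ _ hcpt hK π hπ ℓ _ ι r hrss hc v hvℓ α hα σ d hσ
  classical
  have hℓ : ℓ.Prime := Fact.out
  -- ranks `0` and `1`: compatibility at `v` is unconditional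
  rcases Nat.lt_trichotomy n 1 with hn | rfl | hn
  · obtain rfl : n = 0 := Nat.lt_one_iff.mp hn
    exact weilTrace_of_isGaloisCompatibleAt (corollary93_unramified_rank_zero π ι r v) hα σ d hσ
  · exact weilTrace_of_isGaloisCompatibleAt
      (corollary93_unramified_rank_one hcpt hK π hπ ι r hrss hc v hvℓ) hα σ d hσ
  -- rank `n ≥ 2`; the rational prime `q` below `v`
  obtain ⟨q, hq, hqv⟩ := exists_natPrime_natCast_mem v
  have hqℓ : q ≠ ℓ := by
    rintro rfl
    exact hvℓ hqv
  -- if `π` is unramified above `q`, HLTT-compatibility answers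
  by_cases hπq : π.1.IsUnramifiedAbove q
  · exact weilTrace_of_isGaloisCompatibleAt (hc q hq hqℓ hπq v hqv) hα σ d hσ
  -- otherwise `K` has two places over `q`, so `[K : ℚ] ≥ 2`
  have hK1 : Module.finrank ℚ K = 1 → 2 < n := by
    intro h1
    exfalso
    simp only [AutomorphicRepData.IsUnramifiedAbove, not_forall, exists_prop] at hπq
    obtain ⟨w, hqw, hw⟩ := hπq
    have hne : v ≠ w := by
      rintro rfl
      exact hw ⟨α, hα⟩
    have h2 : HasTwoPrimesOver K q := ⟨v, w, hne, hqv, hqw⟩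
    rw [hasTwoPrimesOver_iff_one_lt_ncard K hq] at h2
    have h3 := ncard_primesOver_span_le_finrank (F₀ := K) hq
    omega
  -- the finite set `B` of bad rational primes
  choose f hf using fun w : HeightOneSpectrum (𝓞 K) ↦ exists_natPrime_natCast_mem w
  have hR : {w : HeightOneSpectrum (𝓞 K) | ¬ Algebra.IsUnramifiedAt ℤ w.asIdeal}.Finite := by
    refine (Ideal.finite_factors (differentIdeal_ne_bot (A := ℤ) (B := 𝓞 K))).subset
      fun w hw ↦ ?_
    simp only [Set.mem_setOf_eq] at hw ⊢
    by_contra hdvd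
    exact hw ((not_dvd_differentIdeal_iff (A := ℤ)).mp hdvd)
  have hcof : {w : HeightOneSpectrum (𝓞 K) | ¬ π.1.IsUnramifiedAt w}.Finite :=
    π.1.hasSatakeParamAt_cofinite_holds
  set B : Set ℕ := f '' ({w | ¬ Algebra.IsUnramifiedAt ℤ w.asIdeal} ∪ {w | ¬ π.1.IsUnramifiedAt w})
    with hBdef
  have hBfin : B.Finite := (hR.union hcof).image f
  have hB : ∀ D : ℕ, D.Prime → D ∉ B → ∀ v : HeightOneSpectrum (𝓞 K),
      ((D : ℕ) : 𝓞 K) ∈ v.asIdeal → Algebra.IsUnramifiedAt ℤ v.asIdeal ∧ π.1.IsUnramifiedAt v := by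
    intro D hD hDB v hv
    have hfv : f v = D := natPrime_eq_of_natCast_mem (hf v).1 hD (hf v).2 hv
    by_contra h
    rw [not_and_or] at h
    exact hDB ⟨v, by simpa [Set.mem_union, Set.mem_setOf_eq] using h, hfv⟩
  have hm : 8 * ℓ ≠ 0 := mul_ne_zero (by norm_num) hℓ.ne_zero
  -- a member `L = K(√-D)` with `8q ∣ D + 1` in which `v` splits completely
  obtain ⟨i, hqi, hsplit⟩ := GoodPrime.exists_dvd_split K (8 * ℓ) B hm hBfin v (8 * q)
    (mul_ne_zero (by norm_num) hq.ne_zero)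
  -- the Frobenius datum of `π` and the representation of the member
  obtain ⟨E, hE⟩ := exists_frobDatum π.1 ι
  obtain ⟨P, ρ, hP, hρss, hρc, hρT⟩ :=
    exists_rep_member_of_prop71 h57 harch hBC hn hK1 hK π hπ ι E hE hB i
  obtain ⟨hρw, hPw⟩ := hρT q hq hqℓ hqi
  -- `ρ ≅ r|_{Γ_L}`: both are compatible almost everywhere with the datum of `π`
  have hrc : CompatibleAE E (r.restrictField (sqrtNegField K i.1)) :=
    compatibleAE_restrictField_of_isCompatible π.1 ι r hc E hE
  obtain ⟨e⟩ := hρc.nonempty_equiv hρss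
    (r.isSemisimple_restrictField (M := sqrtNegField K i.1) hrss) hrc
  -- descend at the completely split `v`
  obtain ⟨he, hf'⟩ := ramificationIdxIn_eq_one_of_ncard_eq_finrank v hsplit
  refine weilTrace_of_restrictField ι r he hf' α (fun w hwv 𝔔 h𝔔 φ' hφ' d' σ' hσ' ↦ ?_) σ d hσ
  have hqw : ((q : ℕ) : 𝓞 (sqrtNegField K i.1)) ∈ w.asIdeal := by
    rw [natCast_mem_iff_natCast_mem_under (K := K) w q]
    change ((q : ℕ) : 𝓞 K) ∈ w.asIdeal.under (𝓞 K)
    rw [hwv]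
    exact hqv
  have htr := hρw w hqw α (hPw v hqv w hwv α hα) 𝔔 h𝔔 φ' hφ' d' σ' hσ'
  -- `charpoly r(res σ') = charpoly ρ(σ')`
  have hcp := FramedRep.charpoly_eq_of_equiv e σ'
  rw [Matrix.trace_eq_sum_roots_charpoly] at htr ⊢
  change (FramedRep.charpoly ρ σ').roots.sum = _ at htr
  change (FramedRep.charpoly (r.restrictField (sqrtNegField K i.1)) σ').roots.sum = _
  rw [hcp]
  exact htr

end Varma2024

end Literature.NumberTheory.Automorphic

end
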